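import Summits.QuantumAdvantage.AdviceFreeQNC0.BondTwistOddSite
import HarnessLib

/-!
# Cell qa-qnc0 — **`twistBoundXOdd : TwistBoundXOdd`** (planner qa-qnc0-p1 g20, `exp20/Sketch20x.lean` §5, VERBATIM)

For `m` odd, a FIXED bell set `B` and `γ ∈ (ZMod m)^N`: the correlation of the win indicator of `tGuess ⊕ 1_B` on the odd
class with `e_m(Σ_{i : x_i} γ_i)` is `≤ 9·cos(π/(2m))^{#supp γ}·2^N`.  Bond-twisted 6-state path sum (`BondPathSum.lean`) with the
per-site factor `4cos²(π/(2m))` at twisted sites (`BondTwistOddSite.lean`); `m = 1` is the untwisted trivial bound.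

WHAT THIS IS NOT: the rung `RingOddModuliFormsSharp3` is assembled separately; crux 22907 untouched; separation NOT moved.
-/

noncomputable section

namespace Summit.QuantumAdvantage.AdviceFreeQNC0

open Finset Literature.Computability.QuantumComplexity Literature.Computability.QuantumComplexity.RingHLF
open Literature.Computability.MetaComplexity

namespace BondTwist3

open TransferWalk ConstBells TwistedTransfer Real

variable {m : ℕ} [NeZero m] {n : ℕ}

/-! ## The norm bookkeeping and the theorem -/

/-- Iterated recursion for modulus `m` (odd): `btvNorm k a ≤ (Π_{g<k} 4·siteRhoM(a+g)²)·btvNorm 0 (a+k)`, `ρ = cos(π/(2m))`. -/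
theorem btvNorm_le_prodM (hm : Odd m) (γ : Fin (n + 1) → ZMod m) (f : ℕ → ZMod 3 → ℝ) (hf : ∀ j s, f j s ^ 2 ≤ 1) :
    ∀ k a : ℕ, btvNorm (phaseM γ) f k a ≤
      (∏ g ∈ range k, 4 * siteRhoM γ (Real.cos (π / (2 * m))) (a + g) ^ 2) * btvNorm (phaseM γ) f 0 (a + k)
  | 0, a => by simp
  | k + 1, a => by
    have hstep : btvNorm (phaseM γ) f (k + 1) a ≤
        4 * siteRhoM γ (Real.cos (π / (2 * m))) a ^ 2 * btvNorm (phaseM γ) f k (a + 1) := by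
      unfold siteRhoM
      by_cases ha : a < n + 1
      · rw [dif_pos ha]
        by_cases h0 : γ ⟨a, ha⟩ = 0
        · rw [if_pos h0, one_pow, mul_one]
          exact btvNorm_succ_le_four _ f hf k a (norm_phaseM_le γ a)
        · rw [if_neg h0]
          have hph : phaseM γ a = (ZMod.stdAddChar (γ ⟨a, ha⟩) : ℂ) := by unfold phaseM; rw [dif_pos ha]
          have h1 := btvNorm_succ_le_re (phaseM γ) f hf k a (by rw [hph]; exact norm_stdAddChar _)
          rw [hph] at h1
          have h2 := two_add_norm_le hm h0
          have hb : 0 ≤ btvNorm (phaseM γ) f k (a + 1) := by unfold btvNorm cnsq6; positivity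
          nlinarith
      · rw [dif_neg ha, one_pow, mul_one]
        exact btvNorm_succ_le_four _ f hf k a (norm_phaseM_le γ a)
    have ih := btvNorm_le_prodM hm γ f hf k (a + 1)
    have hprod : (∏ g ∈ range (k + 1), 4 * siteRhoM γ (Real.cos (π / (2 * m))) (a + g) ^ 2) =
        4 * siteRhoM γ (Real.cos (π / (2 * m))) a ^ 2 *
          ∏ g ∈ range k, 4 * siteRhoM γ (Real.cos (π / (2 * m))) (a + 1 + g) ^ 2 := by
      rw [Finset.prod_range_succ' (fun g => 4 * siteRhoM γ (Real.cos (π / (2 * m))) (a + g) ^ 2), add_zero, mul_comm]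
      congr 1
      exact Finset.prod_congr rfl fun g _ => by rw [show a + (g + 1) = a + 1 + g by omega]
    rw [hprod, show a + (k + 1) = a + 1 + k by omega]
    have hc : 0 ≤ 4 * siteRhoM γ (Real.cos (π / (2 * m))) a ^ 2 := by positivity
    calc btvNorm (phaseM γ) f (k + 1) a
        ≤ 4 * siteRhoM γ (Real.cos (π / (2 * m))) a ^ 2 * btvNorm (phaseM γ) f k (a + 1) := hstep
      _ ≤ 4 * siteRhoM γ (Real.cos (π / (2 * m))) a ^ 2 *
          ((∏ g ∈ range k, 4 * siteRhoM γ (Real.cos (π / (2 * m))) (a + 1 + g) ^ 2) *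
            btvNorm (phaseM γ) f 0 (a + 1 + k)) := mul_le_mul_of_nonneg_left ih hc
      _ = 4 * siteRhoM γ (Real.cos (π / (2 * m))) a ^ 2 *
          (∏ g ∈ range k, 4 * siteRhoM γ (Real.cos (π / (2 * m))) (a + 1 + g) ^ 2) *
            btvNorm (phaseM γ) f 0 (a + 1 + k) := by ring

omit [NeZero m] in
/-- `cos(π/(2m))² ≥ 3/4` for `m ≥ 3`. -/
theorem cos_sq_ge (hm3 : 3 ≤ m) : 3 / 4 ≤ Real.cos (π / (2 * m)) ^ 2 := by
  have hm0 : (0 : ℝ) < m := by exact_mod_cast (show 0 < m by omega)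
  have h3 : (3 : ℝ) ≤ m := by exact_mod_cast hm3
  have hle : π / (2 * m) ≤ π / 6 :=
    div_le_div_of_nonneg_left Real.pi_pos.le (by norm_num) (by linarith)
  have h0 : 0 ≤ π / (2 * m) := by positivity
  have hc : Real.cos (π / 6) ≤ Real.cos (π / (2 * m)) :=
    Real.cos_le_cos_of_nonneg_of_le_pi h0 (by linarith [Real.pi_pos]) hle
  rw [Real.cos_pi_div_six] at hc
  have hs : (Real.sqrt 3 / 2) ^ 2 = 3 / 4 := by rw [div_pow, Real.sq_sqrt (by norm_num)]; norm_num
  rw [← hs]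
  exact pow_le_pow_left₀ (by positivity) hc 2

omit [NeZero m] in
/-- The product of the first `n` site factors (`m ≥ 3` odd): `≤ (4/3)·4ⁿ·(ρ²)^{#supp γ}`. -/
theorem prod_site_leM (hm3 : 3 ≤ m) (γ : Fin (n + 1) → ZMod m) :
    (∏ g ∈ range n, 4 * siteRhoM γ (Real.cos (π / (2 * m))) g ^ 2) ≤
      4 / 3 * (4 : ℝ) ^ n * (Real.cos (π / (2 * m)) ^ 2) ^ (univ.filter fun i : Fin (n + 1) => γ i ≠ 0).card := by
  set ρ := Real.cos (π / (2 * m)) with hρ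
  have hρ2 : 3 / 4 ≤ ρ ^ 2 := cos_sq_ge hm3
  have hρ1 : ρ ^ 2 ≤ 1 := by rw [hρ]; nlinarith [Real.cos_sq_le_one (π / (2 * m))]
  have hfull := prod_siteRhoM_sq γ ρ
  rw [Finset.prod_range_succ] at hfull
  have hsplit : (∏ g ∈ range n, 4 * siteRhoM γ ρ g ^ 2) = (4 : ℝ) ^ n * ∏ g ∈ range n, siteRhoM γ ρ g ^ 2 := by
    rw [Finset.prod_mul_distrib, Finset.prod_const, Finset.card_range]
  rw [hsplit]
  have hlast : 3 / 4 ≤ siteRhoM γ ρ n ^ 2 := by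
    unfold siteRhoM
    split_ifs
    · norm_num
    · exact hρ2
    · norm_num
  have hP : 0 ≤ ∏ g ∈ range n, siteRhoM γ ρ g ^ 2 := Finset.prod_nonneg fun g _ => by positivity
  have h4 : (0 : ℝ) ≤ (4 : ℝ) ^ n := by positivity
  have key : 3 / 4 * ∏ g ∈ range n, siteRhoM γ ρ g ^ 2 ≤ (ρ ^ 2) ^ (univ.filter fun i : Fin (n + 1) => γ i ≠ 0).card := by
    rw [← hfull]; nlinarith [mul_le_mul_of_nonneg_left hlast hP]
  nlinarith

/-- **The twisted sign sum, modulus `m` (odd, `≥ 3`)**: `‖Σ_u e_m(⟨γ, x(u)⟩)·sgnU_B(u)‖ ≤ 9·ρ^{#supp γ}·2ⁿ`, `ρ = cos(π/(2m))`. -/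
theorem norm_sum_char_sgnU_leM (hm : Odd m) (hm3 : 3 ≤ m) (γ : Fin (n + 1) → ZMod m) (c : ℕ) (B : Finset (Fin (n + 1))) :
    ‖∑ u : Fin n → Bool, (ZMod.stdAddChar (∑ i : Fin (n + 1), if xOfU u i then γ i else 0) : ℂ) * (sgnU c B u : ℂ)‖ ≤
      9 * Real.cos (π / (2 * m)) ^ (univ.filter fun i : Fin (n + 1) => γ i ≠ 0).card * (2 : ℝ) ^ n := by
  set ρ := Real.cos (π / (2 * m)) with hρ
  set w := (univ.filter fun i : Fin (n + 1) => γ i ≠ 0).card with hw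
  set κ : ZMod 3 := ((c + 2 * n : ℕ) : ZMod 3)
  have hρ0 : 0 ≤ ρ := by
    rw [hρ]; refine Real.cos_nonneg_of_neg_pi_div_two_le_of_le ?_ ?_
    · have : 0 ≤ π / (2 * m) := by positivity
      linarith [Real.pi_pos]
    · have : (1 : ℝ) ≤ m := by exact_mod_cast (show 1 ≤ m by omega)
      exact div_le_div_of_nonneg_left Real.pi_pos.le (by norm_num) (by linarith)
  -- the twisted sign sum as a sum of three bond-twisted path sums
  have hsum : ∑ u : Fin n → Bool, (ZMod.stdAddChar (∑ i : Fin (n + 1), if xOfU u i then γ i else 0) : ℂ) * (sgnU c B u : ℂ) =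
      ∑ τ : ZMod 3, BTV (phaseM γ) (fT (bellsN B) n κ τ) n 0 0 false := by
    have h : ∀ u : Fin n → Bool,
        (ZMod.stdAddChar (∑ i : Fin (n + 1), if xOfU u i then γ i else 0) : ℂ) * (sgnU c B u : ℂ) =
          ∑ τ : ZMod 3, bondSummand (phaseM γ) (fT (bellsN B) n κ τ) n 0 0 false u := by
      intro u
      rw [sgnU_eq_sum, Complex.ofReal_sum, Finset.mul_sum]
      refine Finset.sum_congr rfl fun τ _ => ?_
      unfold bondSummand
      have e1 : (∏ g ∈ range (n + 1), (fT (bellsN B) n κ τ (0 + g) (0 + posZ u g) : ℂ)) =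
          ((∏ j ∈ range (n + 1), fT (bellsN B) n κ τ j (st u j) : ℝ) : ℂ) := by
        rw [Complex.ofReal_prod]
        exact Finset.prod_congr rfl fun g _ => by rw [zero_add, zero_add, st_eq_posZ]
      have e2 : (∏ g ∈ range (n + 1), bondPh (phaseM γ) (0 + g) (ext false u g) (ext false u (g + 1))) =
          (ZMod.stdAddChar (∑ i : Fin (n + 1), if xOfU u i then γ i else 0) : ℂ) := by
        rw [← bondProd_eq_charM]
        exact Finset.prod_congr rfl fun g _ => by rw [zero_add]
      rw [e1, e2, mul_comm]
    simp_rw [h]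
    rw [Finset.sum_comm]
    exact Finset.sum_congr rfl fun τ _ => bond_pathSum_eq _ _ n 0 0 false
  rw [hsum]
  have hτ : ∀ τ : ZMod 3, ‖BTV (phaseM γ) (fT (bellsN B) n κ τ) n 0 0 false‖ ≤ 3 * (ρ ^ w * (2 : ℝ) ^ n) := by
    intro τ
    have h1 := normSq_le_btvNorm (phaseM γ) (fT (bellsN B) n κ τ) n 0 0 false
    have h2 := btvNorm_le_prodM hm γ (fT (bellsN B) n κ τ) (fT_sq_le (bellsN B) n κ τ) n 0
    simp only [zero_add] at h2
    have h3 := prod_site_leM hm3 γ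
    have h4 := btvNorm_zero_le (phaseM γ) (fT (bellsN B) n κ τ) (fT_sq_le (bellsN B) n κ τ) n (norm_phaseM_le γ _)
    have h5 : 0 ≤ btvNorm (phaseM γ) (fT (bellsN B) n κ τ) 0 n := by unfold btvNorm cnsq6; positivity
    have hsq : ‖BTV (phaseM γ) (fT (bellsN B) n κ τ) n 0 0 false‖ ^ 2 ≤ 8 * (ρ ^ w * (2 : ℝ) ^ n) ^ 2 := by
      have e1 : (ρ ^ w * (2 : ℝ) ^ n) ^ 2 = (ρ ^ 2) ^ w * (4 : ℝ) ^ n := by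
        rw [mul_pow, ← pow_mul, ← pow_mul, mul_comm w 2, mul_comm n 2, pow_mul, pow_mul]; norm_num
      rw [e1]
      calc ‖BTV (phaseM γ) (fT (bellsN B) n κ τ) n 0 0 false‖ ^ 2
          ≤ (∏ g ∈ range n, 4 * siteRhoM γ ρ g ^ 2) * btvNorm (phaseM γ) (fT (bellsN B) n κ τ) 0 n := h1.trans h2
        _ ≤ (4 / 3 * (4 : ℝ) ^ n * (ρ ^ 2) ^ w) * 6 := mul_le_mul h3 h4 h5 (by positivity)
        _ = 8 * ((ρ ^ 2) ^ w * (4 : ℝ) ^ n) := by ring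
    have hX : 0 ≤ ρ ^ w * (2 : ℝ) ^ n := by positivity
    have h9 : ‖BTV (phaseM γ) (fT (bellsN B) n κ τ) n 0 0 false‖ ^ 2 ≤ (3 * (ρ ^ w * (2 : ℝ) ^ n)) ^ 2 := by nlinarith
    exact abs_le_of_sq_le_sq' h9 (by positivity) |>.2
  calc ‖∑ τ : ZMod 3, BTV (phaseM γ) (fT (bellsN B) n κ τ) n 0 0 false‖
      ≤ ∑ τ : ZMod 3, ‖BTV (phaseM γ) (fT (bellsN B) n κ τ) n 0 0 false‖ := norm_sum_le _ _
    _ ≤ ∑ _τ : ZMod 3, 3 * (ρ ^ w * (2 : ℝ) ^ n) := sum_le_sum fun τ _ => hτ τ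
    _ = 9 * ρ ^ w * (2 : ℝ) ^ n := by rw [sum_const, card_univ, ZMod.card]; simp; ring

/-- **`twistBoundXOdd : TwistBoundXOdd` — PROVED** (with `A = 9`). -/
theorem twistBoundXOdd : TwistBoundXOdd := by
  classical
  refine ⟨9, fun m _ hm N B γ => ?_⟩
  set w := (univ.filter fun i : Fin N => γ i ≠ 0).card with hw
  set ρ := Real.cos (π / (2 * m)) with hρ
  -- the trivial bound `‖Σ‖ ≤ 2^N`
  have htriv : ‖∑ x : Fin N → Bool, (ZMod.stdAddChar (∑ i : Fin N, if x i then γ i else 0) : ℂ) *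
      (if (OddZeros x ∧ RingHLF.Rel x (fun k => xor (tGuess x k) (decide (k ∈ B)))) then (1 : ℂ) else 0)‖ ≤
      (2 : ℝ) ^ N := by
    refine (norm_sum_le _ _).trans ?_
    have hterm : ∀ x : Fin N → Bool, ‖(ZMod.stdAddChar (∑ i : Fin N, if x i then γ i else 0) : ℂ) *
        (if (OddZeros x ∧ RingHLF.Rel x (fun k => xor (tGuess x k) (decide (k ∈ B)))) then (1 : ℂ) else 0)‖ ≤ 1 := by
      intro x
      rw [norm_mul, norm_stdAddChar]
      split_ifs <;> simp
    refine (sum_le_sum fun x _ => hterm x).trans ?_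
    rw [sum_const, card_univ, Fintype.card_fun, Fintype.card_bool, Fintype.card_fin]; simp
  -- `m = 1`: no twist
  by_cases hm3 : m < 3
  · have hm1 : m = 1 := by obtain ⟨r, hr⟩ := hm; omega
    subst hm1
    have hw0 : w = 0 := by
      rw [hw, Finset.card_eq_zero, Finset.filter_eq_empty_iff]
      intro i _ h; exact h (Subsingleton.elim _ _)
    rw [hw0, pow_zero, mul_one]
    have : (0 : ℝ) ≤ (2 : ℝ) ^ N := by positivity
    linarith [htriv]
  push Not at hm3
  have hρ2 : 3 / 4 ≤ ρ ^ 2 := cos_sq_ge hm3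
  have hρ0 : 0 ≤ ρ := by
    rw [hρ]; refine Real.cos_nonneg_of_neg_pi_div_two_le_of_le ?_ ?_
    · have : 0 ≤ π / (2 * m) := by positivity
      linarith [Real.pi_pos]
    · have : (1 : ℝ) ≤ m := by exact_mod_cast (show 1 ≤ m by omega)
      exact div_le_div_of_nonneg_left Real.pi_pos.le (by norm_num) (by linarith)
  have hρ1 : ρ ≤ 1 := Real.cos_le_one _
  -- small `N`
  by_cases hN : N ≤ 2
  · have hwN : w ≤ N := (card_filter_le _ _).trans (by simp)
    refine htriv.trans ?_
    have hw2 : ρ ^ 2 ≤ ρ ^ w := pow_le_pow_of_le_one hρ0 hρ1 (by omega)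
    have h2N : (0 : ℝ) < (2 : ℝ) ^ N := by positivity
    nlinarith
  obtain ⟨n, rfl⟩ : ∃ n, N = n + 1 := ⟨N - 1, by omega⟩
  have hn : 2 ≤ n := by omega
  set F : (Fin (n + 1) → Bool) → ℂ := fun x => (ZMod.stdAddChar (∑ i : Fin (n + 1), if x i then γ i else 0) : ℂ) *
    (if (OddZeros x ∧ RingHLF.Rel x (fun k => xor (tGuess x k) (decide (k ∈ B)))) then (1 : ℂ) else 0) with hF
  set G : (Fin n → Bool) → ℂ := fun u => (ZMod.stdAddChar (∑ i : Fin (n + 1), if xOfU u i then γ i else 0) : ℂ) *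
    (if ringWinU (n + 2) (fun g _ => decide (g ∈ B)) u = true then (1 : ℂ) else 0) with hG
  have hodd : ∑ x : Fin (n + 1) → Bool, F x =
      ∑ x ∈ (univ.filter fun x : Fin (n + 1) → Bool => (univ.filter fun j : Fin (n + 1) => x j = false).card % 2 = 1),
        G (uVec x) := by
    rw [← Finset.sum_filter_add_sum_filter_not univ
      (fun x : Fin (n + 1) → Bool => (univ.filter fun j : Fin (n + 1) => x j = false).card % 2 = 1) F]
    have hzero : ∑ x ∈ univ.filter (fun x : Fin (n + 1) → Bool =>
        ¬ (univ.filter fun j : Fin (n + 1) => x j = false).card % 2 = 1), F x = 0 := by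
      refine Finset.sum_eq_zero fun x hx => ?_
      rw [mem_filter] at hx
      have : ¬ (OddZeros x ∧ RingHLF.Rel x (fun k => xor (tGuess x k) (decide (k ∈ B)))) := fun h => hx.2 h.1
      simp only [hF, this, if_false, mul_zero]
    rw [hzero, add_zero]
    refine Finset.sum_congr rfl fun x hx => ?_
    rw [mem_filter] at hx
    have hxo : OddZeros x := hx.2
    have hrel := rel_iff_ringWinU hn x hx.2 (fun x k => xor (tGuess x k) (decide (k ∈ B)))
    have hy' : (fun (g : Fin (n + 1)) (u : Fin n → Bool) =>
        xor (xor (tGuess (xOfU u) g) (decide (g ∈ B))) (tGuess (xOfU u) g)) =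
        fun (g : Fin (n + 1)) (_ : Fin n → Bool) => decide (g ∈ B) := by
      funext g u
      generalize tGuess (xOfU u) g = t
      generalize decide (g ∈ B) = d
      cases t <;> cases d <;> rfl
    rw [hy'] at hrel
    simp only [hF, hG, xOfU_uVec hn x hx.2]
    by_cases hr : RingHLF.Rel x (fun k => xor (tGuess x k) (decide (k ∈ B)))
    · rw [if_pos ⟨hxo, hr⟩, if_pos (hrel.1 hr)]
    · rw [if_neg (fun h => hr h.2), if_neg (fun h => hr (hrel.2 h))]
  rw [hodd, sum_odd_eq_sum_u hn G]
  have hGsplit : ∀ u : Fin n → Bool, G u =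
      ((ZMod.stdAddChar (∑ i : Fin (n + 1), if xOfU u i then γ i else 0) : ℂ) * (sgnU (n + 2) ∅ u : ℂ) -
        (ZMod.stdAddChar (∑ i : Fin (n + 1), if xOfU u i then γ i else 0) : ℂ) * (sgnU (n + 2) B u : ℂ)) / 2 := by
    intro u
    simp only [hG]
    rw [win_indicator_eq, sgnU_empty]
    push_cast
    ring
  simp_rw [hGsplit]
  rw [← Finset.sum_div, Finset.sum_sub_distrib, norm_div, Complex.norm_two]
  have hA := norm_sum_char_sgnU_leM hm hm3 γ (n + 2) ∅
  have hB := norm_sum_char_sgnU_leM hm hm3 γ (n + 2) B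
  have htri := norm_sub_le
    (∑ u : Fin n → Bool, (ZMod.stdAddChar (∑ i : Fin (n + 1), if xOfU u i then γ i else 0) : ℂ) * (sgnU (n + 2) ∅ u : ℂ))
    (∑ u : Fin n → Bool, (ZMod.stdAddChar (∑ i : Fin (n + 1), if xOfU u i then γ i else 0) : ℂ) * (sgnU (n + 2) B u : ℂ))
  rw [pow_succ]
  have hX : 0 ≤ ρ ^ w * (2 : ℝ) ^ n := by positivity
  linarith

end BondTwist3

end Summit.QuantumAdvantage.AdviceFreeQNC0

end
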